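import Literature.Geometry.Manifold.InjOnLocalDiffeomorphInverse
import Mathlib.Analysis.Complex.Basic
import Mathlib.Analysis.Calculus.Deriv.Basic
import Mathlib.Analysis.Calculus.ContDiff.RestrictScalars
import Mathlib.LinearAlgebra.Complex.FiniteDimensional
import Mathlib.RingTheory.Finiteness.Prod

/-!
# Intercept chart of a local family — flat part (crux `WitnessCharge`, stmt-SmoothPoincare4-7824,
line `Sketch`, skeleton v15, stub `stub_interceptChart`, lead c8)

Registered helper `helper_interceptChart_localDiffeo`: the pure inverse-function-theorem content of
stub S5 `stub_interceptChart`, over plain functions `ℂ × ℂ → ℂ × ℂ` (no manifolds).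

Let `G : ℂ × ℂ → ℂ × ℂ` be `C^∞` on an open set `O ∋ (0, 0)` with `G (0, 0) = (0, b₀)`, bijective
real derivative at `(0, 0)`, and such that the first component `w ↦ (G (0, w)).1` has a NONZERO
complex derivative `c` at `w = 0` (in the application `G (a, w) = capCoord (V a w)` is the leaf `a`
read in the cap chart `(t, σ)`, and `t` has a simple zero along the central leaf). Then, with
`H = G⁻¹` the local inverse near `(0, b₀)`, the maps `α b := (H (0, b)).1`, `W b := (H (0, b)).2`
are `C^∞` near `b₀`, `α` is a local diffeomorphism at `b₀` (its derivative is injective because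
`∂_w G.1 (0, 0) = c ≠ 0`), with local inverse `β` near `0 = α b₀`; `wz := W ∘ β`. We record the
source/target `A ∋ b₀`, `T ∋ 0` of the local homeomorphism `α`, the identities
`G (a, wz a) = (0, β a)`, the bijectivity of `dα` on `A`, the non-vanishing of
`∂_w G.1 (a, wz a)` for `a` near `0`, and the local uniqueness of the zero `w = wz a` of
`w ↦ (G (a, w)).1` on a fixed small disc.
-/

noncomputable section

set_option linter.dupNamespace false

open scoped Manifold ContDiff Topology
open Set Filter

namespace Summit.SmoothPoincare4.SmoothPoincare4.Theorems.WitnessCharge.PencilIncompleteness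

/-- `∂_w` of the first component of `G` at `(a, w₀)`, read through the real derivative of `G`:
if `G` is (real) differentiable at `(a, w₀)` then `w ↦ (G (a, w)).1` has real derivative
`ẇ ↦ (DG (a, w₀) (0, ẇ)).1` at `w₀`. -/
private theorem hasFDerivAt_fst_slice {G : ℂ × ℂ → ℂ × ℂ} {a w₀ : ℂ}
    (hG : DifferentiableAt ℝ G (a, w₀)) :
    HasFDerivAt (fun w : ℂ => (G (a, w)).1)
      ((ContinuousLinearMap.fst ℝ ℂ ℂ).comp
        ((fderiv ℝ G (a, w₀)).comp (ContinuousLinearMap.inr ℝ ℂ ℂ))) w₀ := by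
  have h1 : HasFDerivAt (fun w : ℂ => (a, w)) (ContinuousLinearMap.inr ℝ ℂ ℂ) w₀ :=
    hasFDerivAt_prodMk_right a w₀
  have h2 : HasFDerivAt G (fderiv ℝ G (a, w₀)) ((fun w : ℂ => (a, w)) w₀) := hG.hasFDerivAt
  exact (h2.comp w₀ h1).fst

/-- **Registered helper `helper_interceptChart_localDiffeo`** (flat inverse-function-theorem part
of stub S5 `stub_interceptChart`). See the module docstring. -/
theorem helper_interceptChart_localDiffeo :
    ∀ (G : ℂ × ℂ → ℂ × ℂ) (O : Set (ℂ × ℂ)) (b₀ c : ℂ),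
      IsOpen O → ((0 : ℂ), (0 : ℂ)) ∈ O → ContDiffOn ℝ ∞ G O → G (0, 0) = (0, b₀) →
      Function.Bijective (fderiv ℝ G (0, 0)) →
      HasDerivAt (fun w : ℂ => (G (0, w)).1) c 0 → c ≠ 0 →
      ∃ (T A : Set ℂ) (wz α β : ℂ → ℂ),
        IsOpen T ∧ (0 : ℂ) ∈ T ∧ IsOpen A ∧ b₀ ∈ A ∧
        ContDiffOn ℝ ∞ wz T ∧ wz 0 = 0 ∧
        ContDiffOn ℝ ∞ β T ∧ β 0 = b₀ ∧
        ContDiffOn ℝ ∞ α A ∧ α b₀ = 0 ∧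
        (∀ b ∈ A, α b ∈ T ∧ β (α b) = b) ∧
        (∀ a ∈ T, β a ∈ A ∧ α (β a) = a) ∧
        (∀ b ∈ A, Function.Bijective (fderiv ℝ α b)) ∧
        (∀ a ∈ T, (a, wz a) ∈ O ∧ G (a, wz a) = (0, β a)) ∧
        (∀ᶠ a in nhds (0 : ℂ), fderiv ℝ (fun w : ℂ => (G (a, w)).1) (wz a) 1 ≠ 0) ∧
        (∃ r : ℝ, 0 < r ∧ ∀ᶠ a in nhds (0 : ℂ), ∀ w : ℂ, ‖w‖ < r →
          (a, w) ∈ O ∧ ((G (a, w)).1 = 0 → w = wz a)) := by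
  intro G O b₀ c hO h0 hG hG0 hbij hc hc0
  have hn : (∞ : WithTop ℕ∞) ≠ 0 := by simp
  have h1n : (1 : WithTop ℕ∞) ≤ ∞ := by simp
  -- the derivative of `G` at `(0, 0)` as an equivalence
  set L : (ℂ × ℂ) ≃L[ℝ] ℂ × ℂ :=
    Literature.Geometry.Manifold.continuousLinearEquivOfBijective (fderiv ℝ G (0, 0)) hbij with hL
  have hLcoe : (L : (ℂ × ℂ) →L[ℝ] ℂ × ℂ) = fderiv ℝ G (0, 0) :=
    Literature.Geometry.Manifold.coe_continuousLinearEquivOfBijective _ hbij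
  have hG00 : ContDiffAt ℝ ∞ G (0, 0) := hG.contDiffAt (hO.mem_nhds h0)
  have hGd : HasFDerivAt G (L : (ℂ × ℂ) →L[ℝ] ℂ × ℂ) (0, 0) := by
    rw [hLcoe]
    exact (hG00.differentiableAt hn).hasFDerivAt
  -- transversality: `(L (0, ẇ)).1 = ẇ * c`
  have hLc : ∀ v : ℂ, (L (0, v)).1 = v * c := by
    intro v
    have h1 : HasFDerivAt (fun w : ℂ => (G (0, w)).1)
        ((ContinuousLinearMap.fst ℝ ℂ ℂ).comp
          ((fderiv ℝ G (0, 0)).comp (ContinuousLinearMap.inr ℝ ℂ ℂ))) 0 :=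
      hasFDerivAt_fst_slice (hG00.differentiableAt hn)
    have h2 : HasFDerivAt (fun w : ℂ => (G (0, w)).1)
        ((ContinuousLinearMap.smulRight (1 : ℂ →L[ℂ] ℂ) c).restrictScalars ℝ) 0 :=
      hc.hasFDerivAt.restrictScalars ℝ
    have h := congrArg (fun M : ℂ →L[ℝ] ℂ => M v) (h1.unique h2)
    simp only [ContinuousLinearMap.coe_comp, Function.comp_apply, ContinuousLinearMap.inr_apply,
      ContinuousLinearMap.coe_fst', ContinuousLinearMap.coe_restrictScalars',
      ContinuousLinearMap.smulRight_apply, one_apply_eq_self, smul_eq_mul] at h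
    rw [← hLcoe] at h
    exact h
  -- shrink `O` to where `DG` is invertible; inverse function theorem at `(0, 0)`
  set W : Set (ℂ × ℂ) :=
    O ∩ (fderiv ℝ G) ⁻¹' range ((↑) : ((ℂ × ℂ) ≃L[ℝ] ℂ × ℂ) → (ℂ × ℂ) →L[ℝ] ℂ × ℂ) with hW
  have hWo : IsOpen W :=
    (hG.continuousOn_fderiv_of_isOpen hO h1n).isOpen_inter_preimage hO ContinuousLinearEquiv.isOpen
  have h0W : ((0 : ℂ), (0 : ℂ)) ∈ W := ⟨h0, ⟨L, hLcoe.trans rfl⟩⟩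
  set Ψ₀ := hG00.toOpenPartialHomeomorph G hGd hn with hΨ₀
  set Ψ := Ψ₀.restrOpen W hWo with hΨ
  have hΨG : ∀ z, Ψ z = G z := fun z => rfl
  have hΨsrc : Ψ.source = Ψ₀.source ∩ W := Ψ₀.restrOpen_source W hWo
  have h0Ψ : ((0 : ℂ), (0 : ℂ)) ∈ Ψ.source := by
    rw [hΨsrc]
    exact ⟨hG00.mem_toOpenPartialHomeomorph_source hGd hn, h0W⟩
  have hΨW : Ψ.source ⊆ W := by rw [hΨsrc]; exact inter_subset_right
  have hΨO : Ψ.source ⊆ O := fun z hz => (hΨW hz).1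
  -- the inverse `H := Ψ.symm` is `C^∞` on the (open) target
  have hHs : ContDiffOn ℝ ∞ Ψ.symm Ψ.target := by
    refine Literature.Geometry.Manifold.contDiffOn_symm_of_forall_hasFDerivAt_equiv Ψ
      (fun z _ => hΨG z) hn (fun a ha => hG.contDiffAt (hO.mem_nhds (hΨO ha))) fun a ha => ?_
    obtain ⟨e, he⟩ := (hΨW ha).2
    refine ⟨e, ?_⟩
    rw [he]
    exact ((hG.differentiableOn hn _ (hΨO ha)).differentiableAt (hO.mem_nhds (hΨO ha))).hasFDerivAt
  have hb₀tgt : ((0 : ℂ), b₀) ∈ Ψ.target := by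
    have h := Ψ.map_source h0Ψ
    rwa [hΨG, hG0] at h
  have hH0 : Ψ.symm (0, b₀) = (0, 0) := by
    have h := Ψ.left_inv h0Ψ
    rwa [hΨG, hG0] at h
  -- `B := {b | (0, b) ∈ Ψ.target}`, `α b := (H (0, b)).1`, `W' b := (H (0, b)).2`
  set B : Set ℂ := (fun b : ℂ => ((0 : ℂ), b)) ⁻¹' Ψ.target with hB
  have hBo : IsOpen B := Ψ.open_target.preimage (Continuous.prodMk_right 0)
  have hb₀B : b₀ ∈ B := hb₀tgt
  set α : ℂ → ℂ := fun b => (Ψ.symm (0, b)).1 with hα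
  set W' : ℂ → ℂ := fun b => (Ψ.symm (0, b)).2 with hW'
  have hHB : ContDiffOn ℝ ∞ (fun b : ℂ => Ψ.symm ((0 : ℂ), b)) B :=
    hHs.comp (contDiff_prodMk_right (0 : ℂ)).contDiffOn fun b hb => hb
  have hαB : ContDiffOn ℝ ∞ α B := hHB.fst
  have hW'B : ContDiffOn ℝ ∞ W' B := hHB.snd
  have hαb₀ : α b₀ = 0 := by simp only [hα, hH0]
  have hW'b₀ : W' b₀ = 0 := by simp only [hW', hH0]
  -- the derivative of `α` at `b₀` is injective, hence invertible
  have hHd : HasFDerivAt Ψ.symm (L.symm : (ℂ × ℂ) →L[ℝ] ℂ × ℂ) (0, b₀) :=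
    Ψ.hasFDerivAt_symm hb₀tgt (by rw [hH0]; exact hGd)
  set Mα : ℂ →L[ℝ] ℂ := (ContinuousLinearMap.fst ℝ ℂ ℂ).comp
    ((L.symm : (ℂ × ℂ) →L[ℝ] ℂ × ℂ).comp (ContinuousLinearMap.inr ℝ ℂ ℂ)) with hMα
  have hαd : HasFDerivAt α Mα b₀ :=
    (hHd.comp b₀ (hasFDerivAt_prodMk_right (0 : ℂ) b₀)).fst
  have hMα_inj : Function.Injective Mα := by
    refine (injective_iff_map_eq_zero Mα).2 fun σ hσ => ?_
    change (L.symm (0, σ)).1 = 0 at hσ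
    set v := L.symm (0, σ) with hv
    have hLv : L v = (0, σ) := by rw [hv, L.apply_symm_apply]
    have hv2 : v = (0, v.2) := Prod.ext hσ rfl
    have h1 : (L (0, v.2)).1 = 0 := by rw [← hv2, hLv]
    rw [hLc] at h1
    have hv20 : v.2 = 0 := (mul_eq_zero.1 h1).resolve_right hc0
    have hv0 : v = 0 := by rw [hv2, hv20]; rfl
    have h := congrArg Prod.snd hLv
    rw [hv0, map_zero] at h
    exact h.symm
  have hMα_bij : Function.Bijective Mα :=
    ⟨hMα_inj, (LinearMap.injective_iff_surjective (f := (Mα : ℂ →ₗ[ℝ] ℂ))).1 hMα_inj⟩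
  set Lα : ℂ ≃L[ℝ] ℂ := Literature.Geometry.Manifold.continuousLinearEquivOfBijective Mα hMα_bij
    with hLα
  have hLαcoe : (Lα : ℂ →L[ℝ] ℂ) = Mα :=
    Literature.Geometry.Manifold.coe_continuousLinearEquivOfBijective _ hMα_bij
  have hαd' : HasFDerivAt α (Lα : ℂ →L[ℝ] ℂ) b₀ := by rw [hLαcoe]; exact hαd
  have hαb₀c : ContDiffAt ℝ ∞ α b₀ := hαB.contDiffAt (hBo.mem_nhds hb₀B)
  -- inverse function theorem for `α` at `b₀`, restricted to where `dα` is invertible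
  set Wα : Set ℂ := B ∩ (fderiv ℝ α) ⁻¹' range ((↑) : (ℂ ≃L[ℝ] ℂ) → ℂ →L[ℝ] ℂ) with hWα
  have hWαo : IsOpen Wα :=
    (hαB.continuousOn_fderiv_of_isOpen hBo h1n).isOpen_inter_preimage hBo
      ContinuousLinearEquiv.isOpen
  have hb₀Wα : b₀ ∈ Wα := ⟨hb₀B, ⟨Lα, hαd'.fderiv.symm⟩⟩
  set Φ₀ := hαb₀c.toOpenPartialHomeomorph α hαd' hn with hΦ₀
  set Φ := Φ₀.restrOpen Wα hWαo with hΦ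
  have hΦα : ∀ b, Φ b = α b := fun b => rfl
  have hΦsrc : Φ.source = Φ₀.source ∩ Wα := Φ₀.restrOpen_source Wα hWαo
  have hb₀Φ : b₀ ∈ Φ.source := by
    rw [hΦsrc]
    exact ⟨hαb₀c.mem_toOpenPartialHomeomorph_source hαd' hn, hb₀Wα⟩
  have hΦWα : Φ.source ⊆ Wα := by rw [hΦsrc]; exact inter_subset_right
  have hΦB : Φ.source ⊆ B := fun b hb => (hΦWα hb).1
  have hβs : ContDiffOn ℝ ∞ Φ.symm Φ.target := by
    refine Literature.Geometry.Manifold.contDiffOn_symm_of_forall_hasFDerivAt_equiv Φ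
      (fun b _ => hΦα b) hn (fun b hb => hαB.contDiffAt (hBo.mem_nhds (hΦB hb))) fun b hb => ?_
    obtain ⟨e, he⟩ := (hΦWα hb).2
    refine ⟨e, ?_⟩
    rw [he]
    exact ((hαB.differentiableOn hn _ (hΦB hb)).differentiableAt (hBo.mem_nhds (hΦB hb))).hasFDerivAt
  have h0T : (0 : ℂ) ∈ Φ.target := by
    have h := Φ.map_source hb₀Φ
    rwa [hΦα, hαb₀] at h
  have hβ0 : Φ.symm 0 = b₀ := by
    have h := Φ.left_inv hb₀Φ
    rwa [hΦα, hαb₀] at h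
  -- the data
  set β : ℂ → ℂ := fun a => Φ.symm a with hβ
  set wz : ℂ → ℂ := fun a => W' (β a) with hwz
  have hβA : ∀ a ∈ Φ.target, β a ∈ Φ.source := fun a ha => Φ.map_target ha
  have hwz0 : wz 0 = 0 := by
    change W' (Φ.symm 0) = 0
    rw [hβ0, hW'b₀]
  have hkey : ∀ a ∈ Φ.target, Ψ.symm (0, β a) = (a, wz a) := by
    intro a ha
    have h1 : (Ψ.symm (0, β a)).1 = a := by
      change α (β a) = a
      rw [← hΦα]
      exact Φ.right_inv ha
    exact Prod.ext h1 rfl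
  refine ⟨Φ.target, Φ.source, wz, α, β, Φ.open_target, h0T, Φ.open_source, hb₀Φ, ?_, ?_, hβs, hβ0,
    hαB.mono hΦB, hαb₀, ?_, ?_, ?_, ?_, ?_, ?_⟩
  · -- `wz` is smooth on `T`
    exact hW'B.comp hβs fun a ha => hΦB (hβA a ha)
  · -- `wz 0 = 0`
    exact hwz0
  · -- `β ∘ α = id` on `A`
    exact fun b hb => ⟨Φ.map_source hb, Φ.left_inv hb⟩
  · -- `α ∘ β = id` on `T`
    exact fun a ha => ⟨hβA a ha, Φ.right_inv ha⟩
  · -- `dα` is bijective on `A`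
    intro b hb
    obtain ⟨e, he⟩ := (hΦWα hb).2
    rw [← he]
    exact e.bijective
  · -- `(a, wz a) ∈ O` and `G (a, wz a) = (0, β a)`
    intro a ha
    have htgt : ((0 : ℂ), β a) ∈ Ψ.target := hΦB (hβA a ha)
    have hsrc : Ψ.symm (0, β a) ∈ Ψ.source := Ψ.map_target htgt
    rw [hkey a ha] at hsrc
    refine ⟨hΨO hsrc, ?_⟩
    have h := Ψ.right_inv htgt
    rwa [hkey a ha, hΨG] at h
  · -- `∂_w G.1 (a, wz a) ≠ 0` for `a` near `0`
    have hTn : ∀ᶠ a in 𝓝 (0 : ℂ), a ∈ Φ.target := Φ.open_target.mem_nhds h0T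
    -- continuity of `a ↦ DG (a, wz a)` at `0`
    have hwzc : ContinuousAt wz 0 :=
      ((hW'B.comp hβs fun a ha => hΦB (hβA a ha)).continuousOn.continuousAt
        (Φ.open_target.mem_nhds h0T))
    have hpc : ContinuousAt (fun a : ℂ => (a, wz a)) 0 := continuousAt_id.prodMk hwzc
    have hDc : ContinuousAt (fun a : ℂ => fderiv ℝ G (a, wz a)) 0 := by
      refine ContinuousAt.comp (g := fderiv ℝ G) ?_ hpc
      have h00 : ((0 : ℂ), wz 0) ∈ O := by rw [hwz0]; exact h0
      exact (hG.continuousOn_fderiv_of_isOpen hO h1n).continuousAt (hO.mem_nhds h00)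
    have hvc : ContinuousAt (fun a : ℂ => (fderiv ℝ G (a, wz a) (0, 1)).1) 0 :=
      (hDc.clm_apply continuousAt_const).fst
    have hv0 : (fderiv ℝ G ((0 : ℂ), wz 0) (0, 1)).1 ≠ 0 := by
      rw [hwz0, ← hLcoe]
      change (L (0, 1)).1 ≠ 0
      rw [hLc, one_mul]
      exact hc0
    have hev : ∀ᶠ a in 𝓝 (0 : ℂ), (fderiv ℝ G (a, wz a) (0, 1)).1 ≠ 0 := hvc.eventually_ne hv0
    filter_upwards [hTn, hev] with a haT ha
    have hO' : (a, wz a) ∈ O := by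
      have htgt : ((0 : ℂ), β a) ∈ Ψ.target := hΦB (hβA a haT)
      have hsrc : Ψ.symm (0, β a) ∈ Ψ.source := Ψ.map_target htgt
      rw [hkey a haT] at hsrc
      exact hΨO hsrc
    have hd : DifferentiableAt ℝ G (a, wz a) :=
      (hG.differentiableOn hn _ hO').differentiableAt (hO.mem_nhds hO')
    rw [(hasFDerivAt_fst_slice hd).fderiv]
    simpa only [ContinuousLinearMap.coe_comp, Function.comp_apply, ContinuousLinearMap.inr_apply,
      ContinuousLinearMap.coe_fst'] using ha
  · -- local uniqueness of the zero of `w ↦ (G (a, w)).1`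
    set S : Set (ℂ × ℂ) := Ψ.source ∩ G ⁻¹' (Prod.snd ⁻¹' Φ.source) with hS
    have hSo : IsOpen S :=
      (hG.continuousOn.mono hΨO).isOpen_inter_preimage Ψ.open_source
        (Φ.open_source.preimage continuous_snd)
    have h0S : ((0 : ℂ), (0 : ℂ)) ∈ S := by
      refine ⟨h0Ψ, ?_⟩
      show (G (0, 0)).2 ∈ Φ.source
      rw [hG0]
      exact hb₀Φ
    obtain ⟨r, hr, hrS⟩ := Metric.isOpen_iff.1 hSo _ h0S
    refine ⟨r, hr, ?_⟩
    filter_upwards [Metric.ball_mem_nhds (0 : ℂ) hr] with a ha w hw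
    have haw : (a, w) ∈ S := by
      apply hrS
      rw [← ball_prod_same]
      exact ⟨ha, mem_ball_zero_iff.2 hw⟩
    refine ⟨hΨO haw.1, fun hzero => ?_⟩
    set σ := (G (a, w)).2 with hσ
    have hσA : σ ∈ Φ.source := haw.2
    have hGaw : G (a, w) = (0, σ) := Prod.ext hzero rfl
    have hHσ : Ψ.symm (0, σ) = (a, w) := by
      rw [← hGaw, ← hΨG]
      exact Ψ.left_inv haw.1
    have hασ : α σ = a := by simp only [hα, hHσ]
    have hβa : β a = σ := by
      rw [← hασ, ← hΦα]
      exact Φ.left_inv hσA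
    simp only [hwz, hβa, hW', hHσ]

end Summit.SmoothPoincare4.SmoothPoincare4.Theorems.WitnessCharge.PencilIncompleteness
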